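import Literature.NumberTheory.Automorphic.ResGLnCuspidalCohomologyReduction
import Literature.NumberTheory.Automorphic.UmgTwistPairing
import HarnessLib

/-!
# Borel's injectivity of cuspidal cohomology for `Res_{K/ℚ} GL_n`: the reduction with the concrete
# moderate-growth module

Topic `NumberTheory/Automorphic`; namespace `Literature.NumberTheory.Automorphic.ConeDictionary`.
Theorems only; no definition, no named fact, no `sorry`.

`ResGLnCuspidalCohomologyReduction.coneClass_ne_zero_of_primitive` reduces
`Borel1983_coneClass_ne_zero` (`n ≠ 0`) to the existence, when the cone class of `η` vanishes, of a
horizontal primitive of `(jW ⊗ 1) ∘ η` in `C^q(𝔤; W' ⊗ E_λ)` for ANY auxiliary Lie module `W'`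
with a sesquilinear pairing against `W` extending the Petersson form and skew along the `x i`.
Here that auxiliary datum is INSTANTIATED by the tree's analysis (`UmgTwistInvariantModule`,
`UmgTwistPairing`): `W' = W'_T` the smooth functions of uniform moderate growth on `GL_n(𝔸_K)`
with all derivatives continuous and `|det|^s`-twist invariant under `A_G GL_n(K)`, acted on by Lie
derivatives (`umgLieRep`), paired with `W` by `p(Φ, φ) = ∫ conj (|det|^s Φ)↓ (|det|^s φ)↓ dμ`
(`pairing`; sesquilinear by the integrability of moderate growth against cusp forms; extending the
Petersson form along the inclusion `inclW : W ↪ W'_T`; skew along the trace-zero `x i` by Borel's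
integration by parts, `pairing_umgLieRep_left`).  The single remaining input is thus Borel's
regularization theorem proper [Borel 1983, Thm. 3.2, 3.4; Borel 1981 II, 5.3–5.5]: the vanishing
of the cone class (the class of `η` on the locally symmetric spaces `Γ_c \ X⁺`, van Est / de Rham)
yields a `K'_∞`-horizontal primitive of `η` among the cochains with values in the functions of
uniform moderate growth.

* `coneClass_ne_zero_of_umgPrimitive` — the fact's conclusion for `n ≠ 0` from that input alone.

[cite: BorelWallach2000, VII 2.2, II §2.2; XIV 2.3]

## References

* A. Borel, N. Wallach (2000), II §2, VII §2, XIV 2.3 (held). [BorelWallach2000]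
* A. Borel, *Regularization theorems in Lie algebra cohomology. Applications*, Duke Math. J. 50
  (1983), Thm. 3.2, 3.4. [Borel1983Regularization]
* A. Borel, *Stable real cohomology of arithmetic groups II*, Progr. Math. 14 (1981), 5.3–5.5.
-/

noncomputable section

namespace Literature.NumberTheory.Automorphic

-- Mathlib idiom (as in `GKModules`): commutator bracket on matrix algebras and `Module.End`
attribute [local instance 100] LieRing.ofAssociativeRing

open scoped TensorProduct Classical _root_.Matrix
open _root_.NumberField _root_.NumberField.InfinitePlace _root_.NumberField.mixedEmbedding IsDedekindDomain
open _root_.MeasureTheory Literature.Algebra.Lie.ChevalleyEilenberg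

namespace ConeDictionary

open ResGLnCohomology BigHeckeGLn Literature.NumberTheory.DiophantineGeometry

variable {n : ℕ} {K : Type} [Field K] [NumberField K] {hcpt : isCompact_glFiniteIntegralLevel n K}

/-- The pairing of `UmgTwistPairing` is sesquilinear (`n ≠ 0`). [folklore] -/
theorem isSesqPairing_pairing [NeZero n] {π : AutomorphicRepData (AutomorphyDatum.gl n K hcpt)} (T : π.UnitaryTwist)
    (μ : Measure (AdelicGroupData.gl n K).automorphicQuotient) [(AdelicGroupData.gl n K).IsAutomorphicMeasure μ] :
    Kuga.IsSesqPairing (T.pairing μ) where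
  add_left Φ Ψ φ := T.pairing_add_left μ Φ Ψ φ
  smul_left c Φ φ := T.pairing_smul_left μ c Φ φ
  add_right Φ φ ψ := T.pairing_add_right μ Φ φ ψ
  smul_right c Φ φ := T.pairing_smul_right μ c Φ φ

set_option maxHeartbeats 800000 in
set_option synthInstance.maxHeartbeats 200000 in
/-- **Borel's injectivity, reduced to his regularization theorem** (`n ≠ 0`).  Let `π` be a clean
cuspidal automorphic representation of `GL_n(𝔸_K)`, `η ∈ Z^{q+1}(𝔤, K_∞; W ⊗ E_λ)` basic and not a
coboundary, with cone forms `ω_η`; fix an automorphic measure `μ` and a unitary twist `T`, and let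
`W'_T ⊇ W` be the Lie module of smooth functions of uniform moderate growth with the twisted
invariance (`UnitaryTwist.umgSpace`).  If the vanishing of the cone class of `η` yields a
`K'_∞`-horizontal `Ψ ∈ C^q(𝔤; W'_T ⊗ E_λ)` with `dΨ = (inclW ⊗ 1) ∘ η` (Borel's regularization),
then the cone class of `η` is nonzero — by `coneClass_ne_zero_of_primitive` with the pairing
`∫ conj (|det|^s Φ)↓ (|det|^s φ)↓ dμ` (`UnitaryTwist.pairing`: sesquilinear, extending the Petersson
form, skew along the trace-zero `x i`). [cite: BorelWallach2000, VII 2.2, II §2.2] -/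
theorem coneClass_ne_zero_of_umgPrimitive [NeZero n] (𝔫 : Ideal (𝓞 K)) (π : CuspidalAutomorphicRepData n K hcpt)
    (hW' : π.1.W' = ⊥) (S : Finset {w : InfinitePlace K // w.IsReal}) (lam : (K →+* ℂ) → Fin n → ℤ)
    (q : ℕ) (η : Cochain π.1 lam (q + 1)) (hZ : η ∈ (gkComplexLS π.1 S lam).cocycles (q + 1))
    (hins : ins q (⟨1, trivial⟩ : (AutomorphyDatum.gl n K hcpt).arch.lie) η = 0)
    (hB : η ∉ (gkComplexLS π.1 S lam).coboundaries (q + 1))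
    (hω : TwistedQuotient.IsConeFormFamily (diagPos n K) (level n K 𝔫) (coeffRepPos ℂ n K lam)
      ((ResGLnCone.coneActionRat n K).comp (glTotPos n K).subtype) (ResGLnCone.posCone n K)
      (fun c H => coneForm π.1 S lam η c H))
    (μ : Measure (AdelicGroupData.gl n K).automorphicQuotient) [(AdelicGroupData.gl n K).IsAutomorphicMeasure μ]
    (T : π.1.UnitaryTwist)
    (hex : TwistedQuotient.coneClass hω (ResGLnCone.hermOne_mem_posCone n K) = 0 →
      ∃ Ψ : Literature.Algebra.Lie.ChevalleyEilenberg.Cochain ℝ (𝔤D n K hcpt) (Carrier' lam T.umgLieRep) q,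
        Ψ ∈ horizontal (M := Carrier' lam T.umgLieRep) (kPrimeD n K hcpt) q ∧
          d ℝ (𝔤D n K hcpt) (Carrier' lam T.umgLieRep) q Ψ =
            post (𝔤D n K hcpt) (inclT π.1 lam T.umgLieRep T.inclW) (q + 1) η) :
    TwistedQuotient.coneClass hω (ResGLnCone.hermOne_mem_posCone n K) ≠ 0 :=
  coneClass_ne_zero_of_primitive 𝔫 π hW' S lam q η hZ hins hB hω μ T T.umgLieRep (isSesqPairing_pairing T μ)
    (fun i Φ φ => T.pairing_umgLieRep_left μ (xD n K hcpt i) (ResGLnCartan.mixedTrace_trace_x n K i) Φ φ)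
    (fun w w₂ => T.pairing_inclW μ w w₂) hex

end ConeDictionary

end Literature.NumberTheory.Automorphic

end
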